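import Summits.NavierStokesRegularity.NavierStokesRegularity.Theorems.SqueezeCycleExtremalBiaxialitySubcriticalOfRecurrentLiouville
import Summits.NavierStokesRegularity.NavierStokesRegularity.Theorems.SqueezeCycleRecurrentLiouvilleRellichScarResidue
import Summits.NavierStokesRegularity.NavierStokesRegularity.Theorems.SqueezeCycleExtremalBiaxialitySubcriticalQuarterClosed
import Summits.NavierStokesRegularity.NavierStokesRegularity.Theorems.SqueezeCycleExtremalElementExistsRegularity
import Summits.NavierStokesRegularity.NavierStokesRegularity.Theorems.SymmetryModuliCountFarPastLedger
import Literature.Analysis.FluidPDE.TypeIRateOseenMildRepresentative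
import Literature.Analysis.FluidPDE.LocalTypeISlabProfile
import Literature.Analysis.FluidPDE.ClassicalSuitable
import Literature.Analysis.FluidPDE.NSSuitableESSProofs
import Literature.Analysis.FluidPDE.SuitableWeakCongr
import Literature.Analysis.FluidPDE.TaoEnstrophyLocalisationProofs
import HarnessLib

/-!
# Route `SqueezeCycle`, crux `ExtremalBiaxialitySubcritical` (stmt-NavierStokesRegularity-11609):
# the crux is EQUIVALENT, by name, to `RecurrentLiouville` (stmt-1589) and to
# `NoTypeIRateProfile` (stmt-1588) — the line `recurrent-singular-bridge` has no slack

Theorems-only `--supports` helper (line lead c2, 2026-08-17) for the registered skeleton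
`Cruxes/ExtremalBiaxialitySubcritical/Lines/recurrent_singular_bridge.lean`, whose single open stub is
`stub_recurrentLiouville : Theses.RecurrentProfiles.RecurrentLiouville` (item stmt-1589).  Lead c1 landed the
SUFFICIENCY of that stub (`extremalBiaxialitySubcritical_of_recurrentLiouville`).  This file proves its
NECESSITY, so that the crux, the stub, RecurrentProfiles' target and the RellichScar pair are one logical
node, kernel-checked by decl name:

* `noTypeIRateProfile_of_squeezeLiouville` : `SqueezeLiouville → RecurrentProfiles.NoTypeIRateProfile`.
  Proof (Albritton–Barker 2019, Thm 1.1, forward direction, in its slab form; no blow-up is needed):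
  a suitable weak solution on `ℝ³ × (−∞,0)` with `𝐈 < ⊤` and the rate `‖u‖ ≤ C/√(−t)` is a.e. a
  continuous Oseen-mild field `v` with the same rate (`exists_oseenMild_repr_of_typeIBound_lt_top`,
  KNSS 2009 Lemma 3.1 with the parasitic drift killed by the `A`-part of `𝐈`); such a field is jointly
  smooth, divergence free and KNSS-mild between all pairs of negative times
  (`isTypeIAncientMild_of_continuous_oseenMild`, KNSS Prop. 4.1); its scaled energy `A` is bounded by the
  far-past ledger of route SymmetryModuliCount (`FarPastLedger_proof`, item 14060) and its scaled enstrophy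
  `E` by `𝐈` (the weak gradient of `u` is a.e. the classical gradient of `v`); so `v` lies in the class
  `𝒦_{C'}` of the route target, which kills it; and a field vanishing on `t < 0` is not backward-singular
  at the origin.
* `recurrentLiouville_of_squeezeLiouville`, `recurrentLiouville_of_extremalBiaxialitySubcritical`,
  and the equivalences `squeezeLiouville_iff_recurrentLiouville`,
  `extremalBiaxialitySubcritical_iff_recurrentLiouville`, `extremalBiaxialitySubcritical_iff_noTypeIRateProfile`,
  `extremalBiaxialitySubcritical_iff_rellichScar` (`↔ NoApexTypeIProfile ∧ ApexLocalisation`,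
  items 11716 ∧ 11719).

Consequences recorded for the planners: items stmt-11609 (this crux), stmt-11608 (`SqueezeLiouville`),
stmt-1589 and stmt-1588 are pairwise equivalent by kernel-checked theorems; any proof or refutation of one
settles all four.

## References

* D. Albritton, T. Barker, *On local Type I singularities of the Navier–Stokes equations and Liouville
  theorems*, J. Math. Fluid Mech. 21 (2019) = arXiv:1811.00502, Thm. 1.1 (forward direction), §3.
  [AlbrittonBarker2019]
* G. Koch, N. Nadirashvili, G. Seregin, V. Šverák, Acta Math. 203 (2009) = arXiv:0709.3599, Lemma 3.1,
  §4 Prop. 4.1. [KochNadirashviliSereginSverak2009]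
-/

noncomputable section

-- the sub-problem namespace repeats the summit name (D-0017 layout `Summit.<S>.<P>.Theorems`)
set_option linter.dupNamespace false

namespace Summit.NavierStokesRegularity.NavierStokesRegularity.Theorems

open MeasureTheory Set Function Filter Metric TopologicalSpace
open scoped ENNReal NNReal Topology
open Literature.Analysis Literature.Analysis.FluidPDE
open Summit.NavierStokesRegularity.NavierStokesRegularity.Theses

/-! ### The scaled enstrophy of a smooth representative is controlled by `𝐈` -/

/-- **`E`-Morrey clause of a smooth a.e.-representative from `𝐈`.**  If `G` is a weak spatial gradient
of `u` on the backward slab, `v = u` a.e. there with `v` jointly `C^∞` on the open slab, and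
`𝐈(ℝ³ × ℝ₋) ≤ I`, then for every parabolic ball `Q((t₀,x₀), r)` with `t₀ ≤ 0`,
`r⁻¹ ∫_{t₀−r²}^{t₀} ∫_{B(x₀,r)} ‖∇v‖² ≤ I` (operator norm; the weak gradient of `u` is a.e. the classical
gradient of `v`, `E(Q) ≤ 𝐈`, and `‖L‖² ≤ |L|²_F`). [cite: AlbrittonBarker2019, §1 (definition of 𝐈)] -/
theorem gradMorrey_of_typeIBound_of_ae_eq {u v : ℝ → (EuclideanSpace ℝ (Fin 3)) → (EuclideanSpace ℝ (Fin 3))} {p : ℝ → (EuclideanSpace ℝ (Fin 3)) → ℝ}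
    {G : ℝ → (EuclideanSpace ℝ (Fin 3)) → (EuclideanSpace ℝ (Fin 3)) →L[ℝ] (EuclideanSpace ℝ (Fin 3))}
    (hwg : HasWeakSpatialGradientOn (slab (EuclideanSpace ℝ (Fin 3)) (Iio 0) isOpen_Iio) u G)
    (hae : ∀ᵐ w ∂(volume.restrict (Iio (0 : ℝ) ×ˢ (univ : Set (EuclideanSpace ℝ (Fin 3))))), uncurry u w = uncurry v w)
    (hv : ContDiffOn ℝ (⊤ : ℕ∞) (uncurry v) (Iio 0 ×ˢ univ))
    {I : ℝ} (hI0 : 0 ≤ I)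
    (hI : typeIBound (Iio (0 : ℝ) ×ˢ (univ : Set (EuclideanSpace ℝ (Fin 3)))) u p G ≤ ENNReal.ofReal I)
    (x₀ : (EuclideanSpace ℝ (Fin 3))) {t₀ r : ℝ} (ht₀ : t₀ ≤ 0) (hr : 0 < r) :
    r⁻¹ * ∫ t in Ioo (t₀ - r ^ 2) t₀, ∫ x in ball x₀ r, ‖fderiv ℝ (v t) x‖ ^ 2 ≤ I := by
  -- the two weak gradients of `v` on the slab agree a.e.
  have hG' : HasWeakSpatialGradientOn (slab (EuclideanSpace ℝ (Fin 3)) (Iio 0) isOpen_Iio) v G := hwg.congr_ae hae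
  have hv1 : ContDiffOn ℝ 1 (uncurry v) (Iio 0 ×ˢ univ) := hv.of_le (by exact_mod_cast le_top)
  have hGv : HasWeakSpatialGradientOn (slab (EuclideanSpace ℝ (Fin 3)) (Iio 0) isOpen_Iio) v fun t x => fderiv ℝ (v t) x :=
    hasWeakSpatialGradientOn_of_contDiffOn isOpen_Iio Subset.rfl hv1
  have hGG : ∀ᵐ z ∂(volume.restrict (Iio (0 : ℝ) ×ˢ (univ : Set (EuclideanSpace ℝ (Fin 3))))),
      uncurry G z = uncurry (fun t x => fderiv ℝ (v t) x) z := hG'.ae_eq hGv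
  -- the cylinder
  set z₀ : ℝ × (EuclideanSpace ℝ (Fin 3)) := (t₀, x₀) with hz₀
  have hsub : parabolicCylinder r z₀ ⊆ Iio (0 : ℝ) ×ˢ (univ : Set (EuclideanSpace ℝ (Fin 3))) :=
    parabolicCylinder_subset_slab r (z := z₀) ht₀
  have hcyl : parabolicCylinder r z₀ = Ioo (t₀ - r ^ 2) t₀ ×ˢ ball x₀ r := rfl
  -- `E(Q) ≤ 𝐈 ≤ I`
  have hE : cknE r z₀ G ≤ ENNReal.ofReal I :=
    (le_add_self.trans (abScaledSum_le_typeIBound (u := u) (p := p) (G := G) hr hsub)).trans hI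
  have hr0 : ENNReal.ofReal r ≠ 0 := by simpa using hr
  have hlinG : ∫⁻ q in parabolicCylinder r z₀, ENNReal.ofReal (frobeniusNormSq (G q.1 q.2)) ≤
      ENNReal.ofReal (r * I) := by
    calc ∫⁻ q in parabolicCylinder r z₀, ENNReal.ofReal (frobeniusNormSq (G q.1 q.2))
        = ENNReal.ofReal r * ((ENNReal.ofReal r)⁻¹ *
            ∫⁻ q in parabolicCylinder r z₀, ENNReal.ofReal (frobeniusNormSq (G q.1 q.2))) := by
          rw [← mul_assoc, ENNReal.mul_inv_cancel hr0 ENNReal.ofReal_ne_top, one_mul]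
      _ ≤ ENNReal.ofReal r * ENNReal.ofReal I := mul_le_mul_right hE _
      _ = ENNReal.ofReal (r * I) := by rw [← ENNReal.ofReal_mul hr.le]
  -- replace `G` by `∇v` and the Frobenius norm by the operator norm
  set g : ℝ × (EuclideanSpace ℝ (Fin 3)) → ℝ := fun q => ‖fderiv ℝ (v q.1) q.2‖ ^ 2 with hg
  have hg0 : ∀ q, 0 ≤ g q := fun q => by positivity
  have hling : ∫⁻ q in parabolicCylinder r z₀, ENNReal.ofReal (g q) ≤ ENNReal.ofReal (r * I) := by
    have h1 : ∫⁻ q in parabolicCylinder r z₀, ENNReal.ofReal (g q) ≤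
        ∫⁻ q in parabolicCylinder r z₀, ENNReal.ofReal (frobeniusNormSq (fderiv ℝ (v q.1) q.2)) :=
      lintegral_mono fun q => ENNReal.ofReal_le_ofReal (sq_opNorm_le_frobeniusNormSq _)
    have h2 : ∫⁻ q in parabolicCylinder r z₀, ENNReal.ofReal (frobeniusNormSq (fderiv ℝ (v q.1) q.2)) =
        ∫⁻ q in parabolicCylinder r z₀, ENNReal.ofReal (frobeniusNormSq (G q.1 q.2)) := by
      refine lintegral_congr_ae ?_
      filter_upwards [ae_restrict_of_ae_restrict_of_subset hsub hGG] with q hq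
      have hq' : G q.1 q.2 = fderiv ℝ (v q.1) q.2 := by
        simpa only [uncurry] using hq
      rw [hq']
    exact h1.trans (h2.le.trans hlinG)
  -- `g` is continuous on the slab, hence integrable on the cylinder with the right bound
  have hgc : ContinuousOn g (Iio (0 : ℝ) ×ˢ (univ : Set (EuclideanSpace ℝ (Fin 3)))) := by
    have h := continuousOn_fderiv_slice_of_contDiffOn hv1 isOpen_Iio.uniqueDiffOn
    exact (h.norm.pow 2)
  have hgm : AEStronglyMeasurable g (volume.restrict (parabolicCylinder r z₀)) :=
    (hgc.mono hsub).aestronglyMeasurable (isOpen_parabolicCylinder r z₀).measurableSet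
  have hgi : IntegrableOn g (parabolicCylinder r z₀) volume := by
    refine ⟨hgm, ?_⟩
    rw [hasFiniteIntegral_iff_ofReal (Eventually.of_forall hg0)]
    exact hling.trans_lt ENNReal.ofReal_lt_top
  have hint : ∫ q in parabolicCylinder r z₀, g q ≤ r * I := by
    have h := ofReal_integral_eq_lintegral_ofReal hgi (Eventually.of_forall hg0)
    rw [← ENNReal.ofReal_le_ofReal_iff (by positivity), h]
    exact hling
  -- Fubini
  have hfub : ∫ q in parabolicCylinder r z₀, g q =
      ∫ t in Ioo (t₀ - r ^ 2) t₀, ∫ x in ball x₀ r, ‖fderiv ℝ (v t) x‖ ^ 2 := by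
    rw [hcyl]
    have h := setIntegral_prod (μ := (volume : Measure ℝ)) (ν := (volume : Measure (EuclideanSpace ℝ (Fin 3)))) g
      (s := Ioo (t₀ - r ^ 2) t₀) (t := ball x₀ r) (by
        rw [← Measure.volume_eq_prod, ← hcyl]; exact hgi)
    rw [← Measure.volume_eq_prod] at h
    exact h
  rw [← hfub]
  calc r⁻¹ * ∫ q in parabolicCylinder r z₀, g q ≤ r⁻¹ * (r * I) :=
        mul_le_mul_of_nonneg_left hint (inv_nonneg.2 hr.le)
    _ = I := by field_simp

/-! ### The route target kills every Type-I-rate slab profile -/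

/-- **NECESSITY of the line's stub: `SqueezeLiouville → NoTypeIRateProfile`** (Albritton–Barker 2019,
Thm 1.1, forward direction, slab form; module docstring).  A suitable weak solution on `ℝ³ × (−∞,0)` with
weak gradient, `𝐈 < ⊤` and the Type-I rate is a.e. a member of the class `𝒦_{C'}` of the route target
(continuous Oseen-mild representative ⇒ KNSS-mild smooth field; `A` from the far-past ledger, `E` from
`𝐈`), which the target annihilates on `t < 0`; a field that vanishes a.e. on the slab is essentially
bounded on every backward cylinder at the origin, so the origin is not backward-singular.
[cite: AlbrittonBarker2019, Thm 1.1 (forward direction), §3]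
[cite: KochNadirashviliSereginSverak2009, Lemma 3.1 and Prop. 4.1] -/
theorem noTypeIRateProfile_of_squeezeLiouville (hX : SqueezeCycle.SqueezeLiouville) :
    RecurrentProfiles.NoTypeIRateProfile := by
  intro u p G C hsw hwg hI hdec hsing
  -- the continuous Oseen-mild representative and its membership in the KNSS gauge class
  obtain ⟨v, hae, hvc, hvd, hvm, hvC⟩ := exists_oseenMild_repr_of_typeIBound_lt_top hsw hdec hI
  have hv : IsTypeIAncientMild C v := isTypeIAncientMild_of_continuous_oseenMild hvc hvd hvm hvC
  -- constants
  obtain ⟨K, hK⟩ := FarPastLedger_proof C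
  set I : ℝ := (typeIBound (Iio (0 : ℝ) ×ˢ (univ : Set (EuclideanSpace ℝ (Fin 3)))) u p G).toReal with hIdef
  have hI0 : 0 ≤ I := ENNReal.toReal_nonneg
  have hIle : typeIBound (Iio (0 : ℝ) ×ˢ (univ : Set (EuclideanSpace ℝ (Fin 3)))) u p G ≤ ENNReal.ofReal I :=
    (ENNReal.ofReal_toReal hI.ne).symm.le
  set C' : ℝ := max C (max K I) with hC'def
  have hCC' : C ≤ C' := le_max_left _ _
  have hKC' : K ≤ C' := (le_max_left _ _).trans (le_max_right _ _)
  have hIC' : I ≤ C' := (le_max_right _ _).trans (le_max_right _ _)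
  -- the rate with the larger constant
  have hdec' : HasTypeITimeDecay C' v := fun t ht x =>
    (hvC t ht x).trans (div_le_div_of_nonneg_right hCC' (Real.sqrt_nonneg _))
  -- the Oseen identity in the route's written-out form
  obtain ⟨h1, h2, h3, -⟩ := isTypeIAncientMild_iff.1 hv
  -- membership in `𝒦_{C'}` and the kill
  have hzero : ∀ t < 0, ∀ x, v t x = 0 := by
    refine hX C' v ⟨h1, h2, fun s t hst ht x => ?_, hdec', fun x₀ t₀ r ht₀ hr => ⟨?_, ?_⟩⟩
    · rw [h3 s t hst ht x]
      rfl
    · -- `A`-clause from the far-past ledger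
      intro t ht1 ht2
      have ht : t < 0 := lt_of_lt_of_le ht2 ht₀
      have hA := hK v hv t ht x₀ r hr
      calc r⁻¹ * ∫ x in ball x₀ r, ‖v t x‖ ^ 2 ≤ r⁻¹ * (K * r) :=
            mul_le_mul_of_nonneg_left hA (inv_nonneg.2 hr.le)
        _ = K := by field_simp
        _ ≤ C' := hKC'
    · -- `E`-clause from `𝐈`
      exact (gradMorrey_of_typeIBound_of_ae_eq hwg hae h1 hI0 hIle x₀ ht₀ hr).trans hIC'
  -- `u = 0` a.e. on the slab, hence not backward-singular at the origin
  have hu0 : ∀ᵐ w ∂(volume.restrict (Iio (0 : ℝ) ×ˢ (univ : Set (EuclideanSpace ℝ (Fin 3))))),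
      uncurry u w = (0 : ℝ × (EuclideanSpace ℝ (Fin 3)) → (EuclideanSpace ℝ (Fin 3))) w := by
    filter_upwards [hae, ae_restrict_mem (measurableSet_Iio.prod MeasurableSet.univ)] with w hw hwm
    rw [hw]
    exact hzero w.1 hwm.1 w.2
  have h1c := hsing 1 one_pos
  have hsub : parabolicCylinder 1 (0 : ℝ × (EuclideanSpace ℝ (Fin 3))) ⊆ Iio (0 : ℝ) ×ˢ (univ : Set (EuclideanSpace ℝ (Fin 3))) :=
    parabolicCylinder_origin_subset_slab 1
  have h0 : eLpNorm (uncurry u) ∞ (volume.restrict (parabolicCylinder 1 (0 : ℝ × (EuclideanSpace ℝ (Fin 3))))) = 0 := by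
    rw [eLpNorm_congr_ae (ae_restrict_of_ae_restrict_of_subset hsub hu0)]
    exact eLpNorm_zero
  rw [h0] at h1c
  exact ENNReal.zero_ne_top h1c

/-- **The route target implies `RecurrentLiouville`** (stmt-1589, in the SqueezeCycle spelling): by
`recurrentLiouville_iff_noTypeIRateProfile` (recurrence is not load-bearing).
[cite: AlbrittonBarker2019, Thm 1.1 (forward direction), §3] -/
theorem recurrentLiouville_of_squeezeLiouville (hX : SqueezeCycle.SqueezeLiouville) :
    SqueezeCycle.RecurrentLiouville :=
  recurrentLiouville_iff_noTypeIRateProfile.2 (noTypeIRateProfile_of_squeezeLiouville hX)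

/-- **The crux implies its line's single open stub**: `ExtremalBiaxialitySubcritical → RecurrentLiouville`
(crux ⇒ target by `extremalBiaxialitySubcritical_iff_squeezeLiouville`, target ⇒ stub above).
[cite: AlbrittonBarker2019, Thm 1.1 (forward direction), §3] -/
theorem recurrentLiouville_of_extremalBiaxialitySubcritical
    (h : SqueezeCycle.ExtremalBiaxialitySubcritical) : SqueezeCycle.RecurrentLiouville :=
  recurrentLiouville_of_squeezeLiouville (extremalBiaxialitySubcritical_iff_squeezeLiouville.1 h)

/-- **Target ↔ stub**: `SqueezeLiouville ↔ RecurrentLiouville` (items 11608 ↔ 1589).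
[cite: AlbrittonBarker2019, Thm 1.1, §3] -/
theorem squeezeLiouville_iff_recurrentLiouville :
    SqueezeCycle.SqueezeLiouville ↔ SqueezeCycle.RecurrentLiouville :=
  ⟨recurrentLiouville_of_squeezeLiouville, squeezeLiouville_of_recurrentLiouville⟩

/-- **Crux ↔ stub — the line `recurrent-singular-bridge` has no slack**:
`ExtremalBiaxialitySubcritical ↔ RecurrentLiouville` (items 11609 ↔ 1589).
[cite: AlbrittonBarker2019, Thm 1.1, §3] -/
theorem extremalBiaxialitySubcritical_iff_recurrentLiouville : Summit.NavierStokesRegularity.NavierStokesRegularity.Theses.SqueezeCycle.ExtremalBiaxialitySubcritical ↔ Summit.NavierStokesRegularity.NavierStokesRegularity.Theses.SqueezeCycle.RecurrentLiouville :=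
  ⟨recurrentLiouville_of_extremalBiaxialitySubcritical, extremalBiaxialitySubcritical_of_recurrentLiouville⟩

/-- The same equivalence in the RecurrentProfiles spelling of the stub (the two route copies agree
letter for letter). [cite: AlbrittonBarker2019, Thm 1.1, §3] -/
theorem extremalBiaxialitySubcritical_iff_recurrentProfiles_recurrentLiouville :
    SqueezeCycle.ExtremalBiaxialitySubcritical ↔ RecurrentProfiles.RecurrentLiouville :=
  extremalBiaxialitySubcritical_iff_recurrentLiouville

/-- **Crux ↔ RecurrentProfiles' target**: `ExtremalBiaxialitySubcritical ↔ NoTypeIRateProfile`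
(items 11609 ↔ 1588; the latter is also the target of route DulacContraction).
[cite: AlbrittonBarker2019, Thm 1.1, §3] -/
theorem extremalBiaxialitySubcritical_iff_noTypeIRateProfile :
    SqueezeCycle.ExtremalBiaxialitySubcritical ↔ RecurrentProfiles.NoTypeIRateProfile :=
  extremalBiaxialitySubcritical_iff_recurrentLiouville.trans recurrentLiouville_iff_noTypeIRateProfile

/-- **Crux ↔ the RellichScar pair**: `ExtremalBiaxialitySubcritical ↔ (NoApexTypeIProfile ∧ ApexLocalisation)`
(items 11609 ↔ 11716 ∧ 11719). [cite: AlbrittonBarker2019, Thm 1.1, §3] [cite: KNSS2009, (1.6)] -/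
theorem extremalBiaxialitySubcritical_iff_rellichScar :
    SqueezeCycle.ExtremalBiaxialitySubcritical ↔
      (RellichScar.NoApexTypeIProfile ∧ RellichScar.ApexLocalisation) :=
  extremalBiaxialitySubcritical_iff_recurrentLiouville.trans recurrentLiouville_iff_rellichScar

/-- **Target ↔ RecurrentProfiles' target**: `SqueezeLiouville ↔ NoTypeIRateProfile` (items 11608 ↔ 1588):
Type-I Liouville on the smooth KNSS-mild class `𝒦_C` and "no Type-I-rate singular profile in the
Albritton–Barker local-energy class" are the same statement. [cite: AlbrittonBarker2019, Thm 1.1, §3] -/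
theorem squeezeLiouville_iff_noTypeIRateProfile : Summit.NavierStokesRegularity.NavierStokesRegularity.Theses.SqueezeCycle.SqueezeLiouville ↔ Summit.NavierStokesRegularity.NavierStokesRegularity.Theses.RecurrentProfiles.NoTypeIRateProfile :=
  squeezeLiouville_iff_recurrentLiouville.trans recurrentLiouville_iff_noTypeIRateProfile

end Summit.NavierStokesRegularity.NavierStokesRegularity.Theorems

end
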